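import Literature.AlgebraicGeometry.Motives.ThickeningModel
import HarnessLib

/-!
# Naturality of the model `Γ(V) ⊗_{Γ(B)} R ≅ Γ(ι_R⁻¹V)` in `V`, `R` and `P`

`Motives/ThickeningModel` identifies, for a `K`-scheme `P`, an affine open `B` of a `K`-scheme `T`
with ring `Λ = Γ(B, 𝒪_T)`, a `Λ`-algebra `R` (giving `ι_R : P ×_K Spec R → P ×_K T`) and an open
`V ⊆ pr_T⁻¹B`, the ring `Γ(ι_R⁻¹V, 𝒪_{P × Spec R})` with `Γ(V, 𝒪_{P × T}) ⊗_Λ R` through the model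
map `OpenOver.modelHom` (`c ⊗ r ↦ ι_R^*(c) · pr^*(r)`; bijective for `V` affine). This file proves
that the model map is natural:

* `OpenOver.res_modelHom` — in `V`: restriction to `W ⊆ V` on sections is `res ⊗ id` on the model;
* `OpenOver.transitionMap_modelHom` — in `R`: for a `Λ`-algebra map `ψ : R → R'` the pullback of
  functions along the transition map `P × Spec R' → P × Spec R` (`modelTransition`) is `id ⊗ ψ`;
* `OpenOver.sliceMap_modelHom` — in `P`: for a `K`-morphism `q : P' → P` the pullback along
  `q × Spec R : P' × Spec R → P × Spec R` is `(q × T)^* ⊗ id`.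

These are the compatibilities needed to move the deformation-theoretic Step (I) of the proof of
Görtz–Wedhorn II, Lemma 24.72 (restriction to the infinitesimal neighbourhoods
`X_{A₀} ⊆ X_A`, and to the slices `X_{i,A} → X_A`) between the schemes and the flat `Λ`-algebras
`Γ(V)`. All proofs are checks on pure tensors with Mathlib's `Scheme.Hom.appLE` calculus
(`appLE_comp_appLE`, `ΓSpecIso_inv_naturality`).

## References

* U. Görtz, T. Wedhorn, *Algebraic Geometry II: Cohomology of Schemes*, Springer Spektrum (2023),
  doi:10.1007/978-3-658-43031-3: Lemma 24.72, proof, Step (I), p. 548. [GortzWedhorn2023]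
-/

universe u

open CategoryTheory CategoryTheory.Limits AlgebraicGeometry MonoidalCategory
open CartesianMonoidalCategory TensorProduct

noncomputable section

namespace Literature.AlgebraicGeometry.Motives

variable {K : Type u} [Field K] {T : SchemeOver K} {B : T.left.Opens} (hB : IsAffineOpen B)
  (R : Type u) [CommRing R] [Algebra Γ(T.left, B) R] {P : SchemeOver K}

/-- `appLE` only depends on the morphism: transport along an equality of morphisms. [folklore] -/
theorem appLE_eq_of_eq {X Y : Scheme.{u}} {f f' : X ⟶ Y} (h : f = f') (U : Y.Opens) (V : X.Opens)
    (e : V ≤ f ⁻¹ᵁ U) : f.appLE U V e = f'.appLE U V (h ▸ e) := by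
  subst h
  rfl

namespace OpenOver

/-! ### Naturality in `V`: restriction -/

/-- Preimages of nested opens are nested. [folklore] -/
theorem thick_mono {V W : OpenOver (snd P T).left B} (h : W.U ≤ V.U) :
    (W.thick hB R).U ≤ (V.thick hB R).U :=
  fun _ hx => h hx

/-- **The model map commutes with restriction**: for `W ⊆ V`, restricting `ι_R^*(c) · pr^*(r)`
from `ι_R⁻¹V` to `ι_R⁻¹W` gives `ι_R^*(c|_W) · pr^*(r)`, i.e. `res ∘ model = model ∘ (res ⊗ id)`.
[folklore] -/
theorem res_modelHom {V W : OpenOver (snd P T).left B} (h : W.U ≤ V.U)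
    (x : V.Sec ⊗[Γ(T.left, B)] R) :
    res (thick_mono hB R h) (V.modelHom hB R x) =
      W.modelHom hB R (Algebra.TensorProduct.map (res h) (AlgHom.id _ R) x) := by
  induction x using TensorProduct.induction_on with
  | zero => simp only [map_zero]
  | add x y hx hy => simp only [map_add, hx, hy]
  | tmul c r =>
    rw [Algebra.TensorProduct.map_tmul, modelHom_tmul, modelHom_tmul, map_mul, AlgHom.id_apply]
    congr 1
    · exact (res_comap _ _ _ _ _ _).trans (comap_res _ _ _ _ _ _).symm
    · rw [thickConst_apply, thickConst_apply, res_apply, ← CommRingCat.comp_apply,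
        Scheme.Hom.appLE_map]

/-! ### Naturality in `R`: the transition maps -/

section Transition

variable {R} {R' : Type u} [CommRing R'] [Algebra Γ(T.left, B) R'] (ψ : R →ₐ[Γ(T.left, B)] R')

/-- `Spec ψ ≫ (Spec R → T) = (Spec R' → T)` for a `Γ(B)`-algebra map `ψ : R → R'`. [folklore] -/
theorem Spec_map_comp_baseSpec :
    Spec.map (CommRingCat.ofHom ψ.toRingHom) ≫ baseSpec T hB R = baseSpec T hB R' := by
  have : ψ.toRingHom.comp (algebraMap Γ(T.left, B) R) = algebraMap Γ(T.left, B) R' :=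
    RingHom.ext fun a => ψ.commutes a
  rw [baseSpec, baseSpec, ← Spec.map_comp_assoc, ← CommRingCat.ofHom_comp, this]

/-- **The transition map** `Spec R' → Spec R` over `T` of a `Γ(B)`-algebra map `ψ : R → R'`, as a
morphism `modelPt T hB R' → modelPt T hB R` of `K`-schemes (for `ψ : 𝒪/𝔪^{n+2} → 𝒪/𝔪^{n+1}` this
induces the closed immersion `X_{n} ↪ X_{n+1}` of infinitesimal neighbourhoods). [folklore] -/
def modelTransition : modelPt T hB R' ⟶ modelPt T hB R :=
  Over.homMk (Spec.map (CommRingCat.ofHom ψ.toRingHom)) (by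
    change Spec.map _ ≫ baseSpec T hB R ≫ T.hom = baseSpec T hB R' ≫ T.hom
    rw [← Category.assoc, Spec_map_comp_baseSpec])

/-- The scheme morphism underlying the transition map is `Spec ψ`. [folklore] -/
@[simp] theorem modelTransition_left :
    (modelTransition hB ψ).left = Spec.map (CommRingCat.ofHom ψ.toRingHom) := rfl

/-- The transition map is a morphism over `T`. [folklore] -/
@[simp] theorem modelTransition_ι : modelTransition hB ψ ≫ modelPtι T hB R = modelPtι T hB R' := by
  ext : 1
  exact Spec_map_comp_baseSpec hB ψ

/-- `(P × Spec R' → P × Spec R) ≫ ι_R = ι_{R'}`. [folklore] -/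
theorem whiskerLeft_modelTransition_comp_left (P : SchemeOver K) :
    (P ◁ modelTransition hB ψ).left ≫ (P ◁ modelPtι T hB R).left = (P ◁ modelPtι T hB R').left := by
  rw [← Over.comp_left, ← MonoidalCategory.whiskerLeft_comp, modelTransition_ι]

/-- `(P × Spec R' → P × Spec R) ≫ pr_R = pr_{R'} ≫ Spec ψ`. [folklore] -/
theorem whiskerLeft_modelTransition_snd_left (P : SchemeOver K) :
    (P ◁ modelTransition hB ψ).left ≫ (snd P (modelPt T hB R)).left =
      (snd P (modelPt T hB R')).left ≫ (modelTransition hB ψ).left := by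
  rw [← Over.comp_left, whiskerLeft_snd, Over.comp_left]

/-- `ι_{R'}⁻¹V ⊆ (transition)⁻¹(ι_R⁻¹V)` (in fact equal). [folklore] -/
theorem thick_le_preimage_thick (V : OpenOver (snd P T).left B) :
    (V.thick hB R').U ≤ (P ◁ modelTransition hB ψ).left ⁻¹ᵁ (V.thick hB R).U := by
  change (P ◁ modelPtι T hB R').left ⁻¹ᵁ V.U ≤
    (P ◁ modelTransition hB ψ).left ⁻¹ᵁ ((P ◁ modelPtι T hB R).left ⁻¹ᵁ V.U)
  rw [← Scheme.Hom.comp_preimage, whiskerLeft_modelTransition_comp_left]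

/-- **Pullback of functions along the transition map** `Γ(ι_R⁻¹V) → Γ(ι_{R'}⁻¹V)`. [folklore] -/
def transitionMap (V : OpenOver (snd P T).left B) : (V.thick hB R).Sec →+* (V.thick hB R').Sec :=
  ((P ◁ modelTransition hB ψ).left.appLE (V.thick hB R).U (V.thick hB R').U
    (V.thick_le_preimage_thick hB ψ)).hom

/-- Unfolding of `transitionMap`. [folklore] -/
theorem transitionMap_apply (V : OpenOver (snd P T).left B) (s : (V.thick hB R).Sec) :
    V.transitionMap hB ψ s = (P ◁ modelTransition hB ψ).left.appLE (V.thick hB R).U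
      (V.thick hB R').U (V.thick_le_preimage_thick hB ψ) s := rfl

/-- The transition map on `ι_R^*(c)` is `ι_{R'}^*(c)`. [folklore] -/
theorem transitionMap_thickComap (V : OpenOver (snd P T).left B) (c : V.Sec) :
    V.transitionMap hB ψ (V.thickComap hB R c) = V.thickComap hB R' c := by
  rw [transitionMap_apply, comap_apply, comap_apply, ← CommRingCat.comp_apply,
    Scheme.Hom.appLE_comp_appLE,
    appLE_eq_of_eq (whiskerLeft_modelTransition_comp_left hB ψ P)]

/-- The transition map on `pr_R^*(r)` is `pr_{R'}^*(ψ r)`. [folklore] -/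
theorem transitionMap_thickConst (V : OpenOver (snd P T).left B) (r : R) :
    V.transitionMap hB ψ (V.thickConst hB R r) = V.thickConst hB R' (ψ r) := by
  -- the left hand side as the value at `r` of a composite `R → Γ(Spec R) → Γ(ι_{R'}⁻¹V)`
  have h1 : V.transitionMap hB ψ (V.thickConst hB R r) =
      ((Scheme.ΓSpecIso (.of R)).inv ≫ ((P ◁ modelTransition hB ψ).left ≫
        (snd P (modelPt T hB R)).left).appLE ⊤ (V.thick hB R').U le_top) r := by
    rw [← Scheme.Hom.appLE_comp_appLE _ _ ⊤ (V.thick hB R).U (V.thick hB R').U le_top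
      (V.thick_le_preimage_thick hB ψ)]
    rfl
  have h2 : ((P ◁ modelTransition hB ψ).left ≫ (snd P (modelPt T hB R)).left).appLE ⊤
      (V.thick hB R').U le_top = (Spec.map (CommRingCat.ofHom ψ.toRingHom)).appTop ≫
        (snd P (modelPt T hB R')).left.appLE ⊤ (V.thick hB R').U le_top := by
    rw [appLE_eq_of_eq (whiskerLeft_modelTransition_snd_left hB ψ P)]
    erw [Scheme.Hom.comp_appLE]
    rfl
  have h3 : (Scheme.ΓSpecIso (.of R)).inv ≫ (Spec.map (CommRingCat.ofHom ψ.toRingHom)).appTop =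
      CommRingCat.ofHom ψ.toRingHom ≫ (Scheme.ΓSpecIso (.of R')).inv :=
    (Scheme.ΓSpecIso_inv_naturality _).symm
  rw [h1, h2]
  have h4 : ((Scheme.ΓSpecIso (.of R)).inv ≫ (Spec.map (CommRingCat.ofHom ψ.toRingHom)).appTop ≫
      (snd P (modelPt T hB R')).left.appLE ⊤ (V.thick hB R').U le_top) r =
      ((CommRingCat.ofHom ψ.toRingHom ≫ (Scheme.ΓSpecIso (.of R')).inv) ≫
        (snd P (modelPt T hB R')).left.appLE ⊤ (V.thick hB R').U le_top) r := by
    rw [← h3]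
    rfl
  exact h4

/-- **The model map commutes with the transition maps**: pulling back `ι_R^*(c) · pr_R^*(r)` along
`P × Spec R' → P × Spec R` gives `ι_{R'}^*(c) · pr_{R'}^*(ψ r)`, i.e.
`transition ∘ model_R = model_{R'} ∘ (id ⊗ ψ)`. [folklore] -/
theorem transitionMap_modelHom (V : OpenOver (snd P T).left B) (x : V.Sec ⊗[Γ(T.left, B)] R) :
    V.transitionMap hB ψ (V.modelHom hB R x) =
      V.modelHom hB R' (Algebra.TensorProduct.map (AlgHom.id Γ(T.left, B) V.Sec) ψ x) := by
  induction x using TensorProduct.induction_on with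
  | zero => simp only [map_zero]
  | add x y hx hy => simp only [map_add, hx, hy]
  | tmul c r =>
    rw [Algebra.TensorProduct.map_tmul, modelHom_tmul, modelHom_tmul, map_mul, AlgHom.id_apply,
      transitionMap_thickComap, transitionMap_thickConst]

end Transition

/-! ### Naturality in `P`: slices -/

section Slice

variable {P' : SchemeOver K} (q : P' ⟶ P)

/-- `q × T : P' × T → P × T` is a morphism over `T`. [folklore] -/
theorem whiskerRight_snd_left (S : SchemeOver K) :
    (q ▷ S).left ≫ (snd P S).left = (snd P' S).left := by
  rw [← Over.comp_left, whiskerRight_snd]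

/-- The preimage `(q × T)⁻¹V ⊆ P' × T` of an open over `B`. [folklore] -/
abbrev slicePreimage (V : OpenOver (snd P T).left B) : OpenOver (snd P' T).left B :=
  V.preimage (q ▷ T).left (whiskerRight_snd_left q T)

/-- `(q × Spec R) ≫ ι_R = ι'_R ≫ (q × T)` (both are `q × (Spec R → T)`). [folklore] -/
theorem whiskerRight_whiskerLeft_left :
    (q ▷ modelPt T hB R).left ≫ (P ◁ modelPtι T hB R).left =
      (P' ◁ modelPtι T hB R).left ≫ (q ▷ T).left := by
  rw [← Over.comp_left, ← Over.comp_left, whisker_exchange]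

/-- `ι'_R⁻¹((q × T)⁻¹V) ⊆ (q × Spec R)⁻¹(ι_R⁻¹V)` (in fact equal). [folklore] -/
theorem thick_slicePreimage_le (V : OpenOver (snd P T).left B) :
    ((V.slicePreimage q).thick hB R).U ≤ (q ▷ modelPt T hB R).left ⁻¹ᵁ (V.thick hB R).U := by
  change (P' ◁ modelPtι T hB R).left ⁻¹ᵁ ((q ▷ T).left ⁻¹ᵁ V.U) ≤
    (q ▷ modelPt T hB R).left ⁻¹ᵁ ((P ◁ modelPtι T hB R).left ⁻¹ᵁ V.U)
  rw [← Scheme.Hom.comp_preimage, ← Scheme.Hom.comp_preimage, whiskerRight_whiskerLeft_left]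

/-- **Pullback of functions along the slice** `Γ(ι_R⁻¹V) → Γ(ι'_R⁻¹((q × T)⁻¹V))`. [folklore] -/
def sliceMap (V : OpenOver (snd P T).left B) :
    (V.thick hB R).Sec →+* ((V.slicePreimage q).thick hB R).Sec :=
  ((q ▷ modelPt T hB R).left.appLE (V.thick hB R).U ((V.slicePreimage q).thick hB R).U
    (V.thick_slicePreimage_le hB R q)).hom

/-- Unfolding of `sliceMap`. [folklore] -/
theorem sliceMap_apply (V : OpenOver (snd P T).left B) (s : (V.thick hB R).Sec) :
    V.sliceMap hB R q s = (q ▷ modelPt T hB R).left.appLE (V.thick hB R).U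
      ((V.slicePreimage q).thick hB R).U (V.thick_slicePreimage_le hB R q) s := rfl

/-- The slice map on `ι_R^*(c)` is `ι'_R^*((q × T)^* c)`. [folklore] -/
theorem sliceMap_thickComap (V : OpenOver (snd P T).left B) (c : V.Sec) :
    V.sliceMap hB R q (V.thickComap hB R c) = (V.slicePreimage q).thickComap hB R
      (V.comap (q ▷ T).left (whiskerRight_snd_left q T) (V.slicePreimage q) le_rfl c) := by
  rw [sliceMap_apply, comap_apply, comap_apply, comap_apply, ← CommRingCat.comp_apply,
    ← CommRingCat.comp_apply, Scheme.Hom.appLE_comp_appLE, Scheme.Hom.appLE_comp_appLE,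
    appLE_eq_of_eq (whiskerRight_whiskerLeft_left hB R q)]

/-- The slice map on `pr_R^*(r)` is `pr'_R^*(r)`. [folklore] -/
theorem sliceMap_thickConst (V : OpenOver (snd P T).left B) (r : R) :
    V.sliceMap hB R q (V.thickConst hB R r) = (V.slicePreimage q).thickConst hB R r := by
  rw [sliceMap_apply, thickConst_apply, thickConst_apply, ← CommRingCat.comp_apply,
    Scheme.Hom.appLE_comp_appLE, appLE_eq_of_eq (whiskerRight_snd_left q (modelPt T hB R))]

/-- **The model map commutes with slices**: pulling back `ι_R^*(c) · pr_R^*(r)` along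
`q × Spec R : P' × Spec R → P × Spec R` gives `ι'_R^*((q × T)^*c) · pr'_R^*(r)`, i.e.
`slice ∘ model_P = model_{P'} ∘ ((q × T)^* ⊗ id)`. [folklore] -/
theorem sliceMap_modelHom (V : OpenOver (snd P T).left B) (x : V.Sec ⊗[Γ(T.left, B)] R) :
    V.sliceMap hB R q (V.modelHom hB R x) =
      (V.slicePreimage q).modelHom hB R (Algebra.TensorProduct.map
        (V.comap (q ▷ T).left (whiskerRight_snd_left q T) (V.slicePreimage q) le_rfl)
        (AlgHom.id _ R) x) := by
  induction x using TensorProduct.induction_on with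
  | zero => simp only [map_zero]
  | add x y hx hy => simp only [map_add, hx, hy]
  | tmul c r =>
    rw [Algebra.TensorProduct.map_tmul, modelHom_tmul, modelHom_tmul, map_mul, AlgHom.id_apply,
      sliceMap_thickComap, sliceMap_thickConst]

end Slice

end OpenOver

end Literature.AlgebraicGeometry.Motives

end
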